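import Summits.QuantumFields.BalabanUV.T4Continuum.Support.NE7LawLevelTower

/-!
# NE7, ROAD P4 (law-level): NODE Q.old, item (k10b) — THE TERM MIXTURE: L²-projection optimality and the
# Poincaré profile of a FINITE MIXTURE of fibre laws (main term + weighted large-field terms)

(Cell `pub-balaban`, sub-cell `t4`, binder row NE7 = node U5, co-owner #4 `b2b-balaban-t4-ne7-p4`, gen 4; skeleton
`HOME/t4/skeletons/NE7-t4-ne7-p4.md` v1.9.4 §2 NODE Q.old; `HOME/t4/b2b-balaban-t4-ne7-p4/g3/PROOF-QV-NE7-P4.md` v1.2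
§6 (6b) «term mixture»: the T-fibre law of one level over a fixed next state is a MIXTURE over the level's term label
`Z` — the main (no-large-field) term `Z = ∅`, for which leaf (QV) gives a Poincaré profile, plus large-field terms of
small weight, each contributing its within-term variance and its between-term mean shift.  This file types exactly
that bookkeeping; item (k10a) `NE7LawLevelTower` typed the companion resampling stage (6a).)

HONEST FRAMING (T4-DAG PAGE 1).  Rung (B)+1 on ONE FIXED finite four-torus, CONDITIONAL on `BetaPertH` and the nine
spine estimates (0/9 proved); NOT infinite volume, NOT a mass gap, NOT the Clay problem.  NE7 is NOT PRINTED and NOT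
proved here.  Pure [folklore] measure theory ∕ finite-sum algebra over plain data, sorry-free; nothing of the audited
series is asserted; NOT summit progress.

WHAT IS PROVED.
* §1 `integral_sq_sub_eq_add_of_version` ∕ `integral_sq_sub_condExp_le_of_version` — L²-PROJECTION OPTIMALITY: for
  `m ≤ mΩ`, a bounded strongly measurable `g` and ANY bounded `m`-strongly-measurable `h`,
  `∫ (g − h)² = ∫ (g − μ[g|m])² + ∫ (μ[g|m] − h)²`, hence `∫ (g − μ[g|m])² ≤ ∫ (g − h)²` (the conditional variance is
  beaten by the mean square distance to any coarse predictor — so a layer budget may be certified with a CONVENIENT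
  predictor, e.g. the main term's own fibre mean, instead of the true conditional mean of the mixture).
* §2 `integral_sq_sub_le_of_mixture(_split)` — FINITE MIXTURE, pure measure algebra (no conditional expectation): if
  `μ = Σ_{z∈labels} μs z`, then `∫ (g − h z₀)² dμ ≤ V z₀ + Σ_{z≠z₀} R z` from per-term bounds measured against the
  MAIN predictor `h z₀`; and the split form `R z ≤ 2(V z + Bt z)` from a within-term bound `∫ (g − h z)² d(μs z) ≤ V z`
  and a between-term shift `∫ (h z − h z₀)² d(μs z) ≤ Bt z` (DICTIONARY: `μs z` = the joint law restricted to
  «the level's term label is `z`»; `V z` = weight × within-term fibre variance; `Bt z` = weight × squared shift of the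
  term-`z` fibre mean from the main one — PROOF-QV §6 (6b)).
* §3 `integral_sq_sub_condExp_le_of_mixture(_split)` — §1 + §2: the same bounds for `∫ (g − μ[g|m])² dμ` as soon as the
  main predictor `h z₀` is `m`-measurable.
* §4 `poincareProfile_of_mixture` — THE COMBINATOR: if for every bounded `m₁`-measurable `g` the main term admits an
  `m₂`-measurable bounded predictor with `∫ (g − h₀)² d(μs z₀) ≤ Σ_b c z₀ b·(D b g)²` and every other term satisfies
  `∫ (g − h₀)² d(μs z) ≤ Σ_b c z b·(D b g)²` with PER-SITE coefficients obeying `c z₀ b ≤ C₀` and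
  `Σ_{z≠z₀} c z b ≤ C′` for every site (DICTIONARY: `C₀ = C_QV g²` of (QV); `c z b` = weight of term `z` × (the
  profile constant far from its large-field region, or the squared oscillation count near it); the per-site sum over
  terms is the «every bond is near at most a weighted O(1) of large-field regions» count of (0.1)∕(1.100)-type
  weights — [PRINTED-1RUN type, read pointwise in the coarse field: dict over NODE O]), then
  `PoincareProfile μ m₁ m₂ (C₀ + C′) sites D`.
Nothing here is an estimate for Bałaban's laws; (QV), the weights and the shifts are hypotheses over plain data.
-/

noncomputable section

open MeasureTheory Finset
open scoped BigOperators

namespace Summit.QuantumFields.BalabanUV.T4Continuum.NE7LawLevel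

open Literature.MathematicalPhysics.QuantumFieldTheory.Balaban1983to89
open Literature.MathematicalPhysics.QuantumFieldTheory.Balaban1983to89.T4MeanChannel

/-! ## §1 L²-projection optimality of the conditional expectation -/

section Projection

variable {Ω : Type*} {mΩ : MeasurableSpace Ω} {μ : Measure Ω}

/-- **PYTHAGORAS FOR A COARSE PREDICTOR.**  For `m ≤ mΩ`, a bounded strongly measurable `g` and a bounded
`m`-strongly-measurable `h`: `∫ (g − h)² = ∫ (g − μ[g|m])² + ∫ (μ[g|m] − h)²` (the cross term vanishes through the
mean channel: `μ[g − μ[g|m] | m] = 0`). [folklore] -/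
theorem integral_sq_sub_eq_add_of_version [IsFiniteMeasure μ] {m : MeasurableSpace Ω} (hm : m ≤ mΩ)
    {g : Ω → ℝ} (hgm : StronglyMeasurable[mΩ] g) {B : ℝ} (hgb : ∀ ω, |g ω| ≤ B)
    {h : Ω → ℝ} (hhm : StronglyMeasurable[m] h) {B' : ℝ} (hhb : ∀ ω, |h ω| ≤ B') :
    ∫ ω, (g ω - h ω) ^ 2 ∂μ =
      ∫ ω, (g ω - μ[g|m] ω) ^ 2 ∂μ + ∫ ω, (μ[g|m] ω - h ω) ^ 2 ∂μ := by
  haveI : SigmaFinite (μ.trim hm) := inferInstance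
  set E := μ[g|m] with hE
  have hgam : AEStronglyMeasurable[mΩ] g μ := hgm.aestronglyMeasurable
  have hham : AEStronglyMeasurable[mΩ] h μ := (hhm.mono hm).aestronglyMeasurable
  have hEsm : StronglyMeasurable[m] E := stronglyMeasurable_condExp
  have hEam : AEStronglyMeasurable[mΩ] E μ := (hEsm.mono hm).aestronglyMeasurable
  have hgi : Integrable g μ := integrable_of_ae_abs_le hgam (ae_of_all μ hgb)
  have hEi : Integrable E μ := integrable_condExp
  have hhi : Integrable h μ := integrable_of_ae_abs_le hham (ae_of_all μ hhb)
  have hEb : ∀ᵐ ω ∂μ, |E ω| ≤ B := ae_abs_condExp_le hgb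
  -- the three squares are integrable
  have hgE2 : Integrable (fun ω => (g ω - E ω) ^ 2) μ :=
    integrable_sq_of_ae_abs_le (hgam.sub hEam) (bu := B + B)
      (by filter_upwards [hEb] with ω hω; exact (abs_sub _ _).trans (add_le_add (hgb ω) hω))
  have hEh2 : Integrable (fun ω => (E ω - h ω) ^ 2) μ :=
    integrable_sq_of_ae_abs_le (hEam.sub hham) (bu := B + B')
      (by filter_upwards [hEb] with ω hω; exact (abs_sub _ _).trans (add_le_add hω (hhb ω)))
  -- the cross term: (E − h) is m-measurable, (g − E) has conditional mean zero
  have hDsm : StronglyMeasurable[m] (fun ω => E ω - h ω) := hEsm.sub hhm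
  have hcr : Integrable (fun ω => (E ω - h ω) * (g ω - E ω)) μ := by
    refine (hgi.sub hEi).bdd_mul ((hEam.sub hham)) (c := B + B') ?_
    filter_upwards [hEb] with ω hω
    rw [Real.norm_eq_abs]
    exact (abs_sub _ _).trans (add_le_add hω (hhb ω))
  have htow : μ[(fun ω => g ω - E ω) | m] =ᵐ[μ] 0 := by
    have h1 : μ[(fun ω => g ω - E ω) | m] =ᵐ[μ] μ[g|m] - μ[E|m] := condExp_sub hgi hEi m
    have h2 : μ[E|m] = E := condExp_of_stronglyMeasurable hm hEsm hEi
    filter_upwards [h1] with ω hω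
    rw [hω, Pi.sub_apply, h2, Pi.zero_apply, sub_self]
  have hcross : ∫ ω, (E ω - h ω) * (g ω - E ω) ∂μ = 0 :=
    integral_mul_eq_zero_of_condExp_ae_eq_zero hm hDsm (hgi.sub hEi) hcr htow
  have heq : (fun ω => (g ω - h ω) ^ 2) =
      fun ω => ((g ω - E ω) ^ 2 + 2 * ((E ω - h ω) * (g ω - E ω))) + (E ω - h ω) ^ 2 := by
    funext ω; ring
  have hX : Integrable (fun ω => (g ω - E ω) ^ 2 + 2 * ((E ω - h ω) * (g ω - E ω))) μ :=
    hgE2.add (hcr.const_mul 2)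
  have hY : Integrable (fun ω => 2 * ((E ω - h ω) * (g ω - E ω))) μ := hcr.const_mul 2
  rw [heq, integral_add hX hEh2, integral_add hgE2 hY, integral_const_mul, hcross, mul_zero, add_zero]

/-- **L²-PROJECTION OPTIMALITY.**  For `m ≤ mΩ`, a bounded strongly measurable `g` and ANY bounded
`m`-strongly-measurable predictor `h`: `∫ (g − μ[g|m])² ≤ ∫ (g − h)²`. [folklore] -/
theorem integral_sq_sub_condExp_le_of_version [IsFiniteMeasure μ] {m : MeasurableSpace Ω} (hm : m ≤ mΩ)
    {g : Ω → ℝ} (hgm : StronglyMeasurable[mΩ] g) {B : ℝ} (hgb : ∀ ω, |g ω| ≤ B)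
    {h : Ω → ℝ} (hhm : StronglyMeasurable[m] h) {B' : ℝ} (hhb : ∀ ω, |h ω| ≤ B') :
    ∫ ω, (g ω - μ[g|m] ω) ^ 2 ∂μ ≤ ∫ ω, (g ω - h ω) ^ 2 ∂μ := by
  rw [integral_sq_sub_eq_add_of_version hm hgm hgb hhm hhb]
  exact le_add_of_nonneg_right (integral_nonneg fun ω => sq_nonneg _)

end Projection

/-! ## §2 Finite mixtures: pure measure algebra -/

section Mixture

variable {Ω : Type*} {mΩ : MeasurableSpace Ω} {Z : Type*}

/-- Integrability of a squared difference of bounded strongly measurable functions on a finite measure space.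
[folklore] -/
theorem integrable_sq_sub_of_bounded (ν : Measure Ω) [IsFiniteMeasure ν] {g h : Ω → ℝ}
    (hgm : StronglyMeasurable g) (hhm : StronglyMeasurable h) {B B' : ℝ} (hgb : ∀ ω, |g ω| ≤ B)
    (hhb : ∀ ω, |h ω| ≤ B') : Integrable (fun ω => (g ω - h ω) ^ 2) ν :=
  integrable_sq_of_ae_abs_le (hgm.aestronglyMeasurable.sub hhm.aestronglyMeasurable) (bu := B + B')
    (ae_of_all ν fun ω => (abs_sub _ _).trans (add_le_add (hgb ω) (hhb ω)))

/-- **FINITE MIXTURE, RAW FORM.**  If `μ = Σ_{z∈labels} μs z` (finite measures), `z₀ ∈ labels`, and the mean square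
distance of `g` to the MAIN predictor `h₀` is `≤ V₀` under `μs z₀` and `≤ R z` under every other `μs z`, then
`∫ (g − h₀)² dμ ≤ V₀ + Σ_{z∈labels∖{z₀}} R z`. [folklore] -/
theorem integral_sq_sub_le_of_mixture [DecidableEq Z] {μ : Measure Ω} (labels : Finset Z) (μs : Z → Measure Ω)
    [∀ z, IsFiniteMeasure (μs z)] (hμ : (∑ z ∈ labels, μs z) = μ) {z₀ : Z} (hz₀ : z₀ ∈ labels) {g h₀ : Ω → ℝ}
    (hgm : StronglyMeasurable g) (hhm : StronglyMeasurable h₀) {B B' : ℝ} (hgb : ∀ ω, |g ω| ≤ B)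
    (hhb : ∀ ω, |h₀ ω| ≤ B') {V₀ : ℝ} {R : Z → ℝ} (hV₀ : ∫ ω, (g ω - h₀ ω) ^ 2 ∂(μs z₀) ≤ V₀)
    (hR : ∀ z ∈ labels, z ≠ z₀ → ∫ ω, (g ω - h₀ ω) ^ 2 ∂(μs z) ≤ R z) :
    ∫ ω, (g ω - h₀ ω) ^ 2 ∂μ ≤ V₀ + ∑ z ∈ labels.erase z₀, R z := by
  have hint : ∀ z ∈ labels, Integrable (fun ω => (g ω - h₀ ω) ^ 2) (μs z) :=
    fun z _ => integrable_sq_sub_of_bounded (μs z) hgm hhm hgb hhb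
  rw [← hμ, integral_finsetSum_measure hint, ← add_sum_erase labels _ hz₀]
  exact add_le_add hV₀ (sum_le_sum fun z hz => hR z (mem_of_mem_erase hz) (ne_of_mem_erase hz))

/-- **THE SPLIT OF A NON-MAIN TERM** (within-term variance + between-term shift): pointwise
`(g − h₀)² ≤ 2(g − h)² + 2(h − h₀)²`, integrated against a finite measure. [folklore] -/
theorem integral_sq_sub_le_two_mul_add (ν : Measure Ω) [IsFiniteMeasure ν] {g h h₀ : Ω → ℝ}
    (hgm : StronglyMeasurable g) (hhm : StronglyMeasurable h) (hh₀m : StronglyMeasurable h₀) {B B' B₀ : ℝ}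
    (hgb : ∀ ω, |g ω| ≤ B) (hhb : ∀ ω, |h ω| ≤ B') (hh₀b : ∀ ω, |h₀ ω| ≤ B₀) {V Bt : ℝ}
    (hV : ∫ ω, (g ω - h ω) ^ 2 ∂ν ≤ V) (hBt : ∫ ω, (h ω - h₀ ω) ^ 2 ∂ν ≤ Bt) :
    ∫ ω, (g ω - h₀ ω) ^ 2 ∂ν ≤ 2 * (V + Bt) := by
  have h1 : Integrable (fun ω => (g ω - h ω) ^ 2) ν := integrable_sq_sub_of_bounded ν hgm hhm hgb hhb
  have h2 : Integrable (fun ω => (h ω - h₀ ω) ^ 2) ν := integrable_sq_sub_of_bounded ν hhm hh₀m hhb hh₀b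
  have hle : ∀ ω, (g ω - h₀ ω) ^ 2 ≤ 2 * (g ω - h ω) ^ 2 + 2 * (h ω - h₀ ω) ^ 2 := by
    intro ω; nlinarith [sq_nonneg ((g ω - h ω) - (h ω - h₀ ω))]
  calc ∫ ω, (g ω - h₀ ω) ^ 2 ∂ν ≤ ∫ ω, 2 * (g ω - h ω) ^ 2 + 2 * (h ω - h₀ ω) ^ 2 ∂ν :=
        integral_mono_of_nonneg (ae_of_all ν fun ω => sq_nonneg _) ((h1.const_mul 2).add (h2.const_mul 2))
          (ae_of_all ν hle)
    _ = 2 * ∫ ω, (g ω - h ω) ^ 2 ∂ν + 2 * ∫ ω, (h ω - h₀ ω) ^ 2 ∂ν := by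
        rw [integral_add (h1.const_mul 2) (h2.const_mul 2), integral_const_mul, integral_const_mul]
    _ ≤ 2 * (V + Bt) := by linarith

/-- **FINITE MIXTURE, SPLIT FORM** (PROOF-QV §6 (6b) verbatim: within-term variances + between-term shifts): with
`μ = Σ_{z∈labels} μs z`, a main predictor `h z₀` and per-term predictors `h z`,
`∫ (g − h z₀)² dμ ≤ V z₀ + 2·Σ_{z≠z₀} (V z + Bt z)` from `∫ (g − h z)² d(μs z) ≤ V z` (all `z`) and
`∫ (h z − h z₀)² d(μs z) ≤ Bt z` (`z ≠ z₀`). [folklore] -/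
theorem integral_sq_sub_le_of_mixture_split [DecidableEq Z] {μ : Measure Ω} (labels : Finset Z)
    (μs : Z → Measure Ω) [∀ z, IsFiniteMeasure (μs z)] (hμ : (∑ z ∈ labels, μs z) = μ) {z₀ : Z}
    (hz₀ : z₀ ∈ labels) {g : Ω → ℝ} {h : Z → Ω → ℝ} (hgm : StronglyMeasurable g)
    (hhm : ∀ z ∈ labels, StronglyMeasurable (h z)) {B B' : ℝ} (hgb : ∀ ω, |g ω| ≤ B)
    (hhb : ∀ z ∈ labels, ∀ ω, |h z ω| ≤ B') {V Bt : Z → ℝ}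
    (hV : ∀ z ∈ labels, ∫ ω, (g ω - h z ω) ^ 2 ∂(μs z) ≤ V z)
    (hBt : ∀ z ∈ labels, z ≠ z₀ → ∫ ω, (h z ω - h z₀ ω) ^ 2 ∂(μs z) ≤ Bt z) :
    ∫ ω, (g ω - h z₀ ω) ^ 2 ∂μ ≤ V z₀ + 2 * ∑ z ∈ labels.erase z₀, (V z + Bt z) := by
  rw [mul_sum]
  refine integral_sq_sub_le_of_mixture labels μs hμ hz₀ hgm (hhm z₀ hz₀) hgb (hhb z₀ hz₀) (hV z₀ hz₀) ?_
  intro z hz hne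
  exact integral_sq_sub_le_two_mul_add (μs z) hgm (hhm z hz) (hhm z₀ hz₀) hgb (hhb z hz) (hhb z₀ hz₀)
    (hV z hz) (hBt z hz hne)

end Mixture

/-! ## §3 The conditional variance of a mixture -/

section CondMixture

variable {Ω : Type*} {mΩ : MeasurableSpace Ω} {μ : Measure Ω} {Z : Type*}

/-- **CONDITIONAL VARIANCE OF A FINITE MIXTURE, RAW FORM.**  If `μ = Σ_{z∈labels} μs z`, the main predictor `h₀` is
`m`-measurable (`m ≤ mΩ`) and bounded, `∫ (g − h₀)² d(μs z₀) ≤ V₀` and `∫ (g − h₀)² d(μs z) ≤ R z` (`z ≠ z₀`), then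
`∫ (g − μ[g|m])² dμ ≤ V₀ + Σ_{z≠z₀} R z`. [folklore] -/
theorem integral_sq_sub_condExp_le_of_mixture [IsFiniteMeasure μ] [DecidableEq Z] {m : MeasurableSpace Ω}
    (hm : m ≤ mΩ) (labels : Finset Z) (μs : Z → Measure[mΩ] Ω) [∀ z, IsFiniteMeasure (μs z)]
    (hμ : (∑ z ∈ labels, μs z) = μ) {z₀ : Z} (hz₀ : z₀ ∈ labels) {g h₀ : Ω → ℝ} (hgm : StronglyMeasurable[mΩ] g)
    (hhm : StronglyMeasurable[m] h₀) {B B' : ℝ} (hgb : ∀ ω, |g ω| ≤ B) (hhb : ∀ ω, |h₀ ω| ≤ B') {V₀ : ℝ}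
    {R : Z → ℝ} (hV₀ : ∫ ω, (g ω - h₀ ω) ^ 2 ∂(μs z₀) ≤ V₀)
    (hR : ∀ z ∈ labels, z ≠ z₀ → ∫ ω, (g ω - h₀ ω) ^ 2 ∂(μs z) ≤ R z) :
    ∫ ω, (g ω - μ[g|m] ω) ^ 2 ∂μ ≤ V₀ + ∑ z ∈ labels.erase z₀, R z :=
  (integral_sq_sub_condExp_le_of_version hm hgm hgb hhm hhb).trans
    (integral_sq_sub_le_of_mixture labels μs hμ hz₀ hgm (hhm.mono hm) hgb hhb hV₀ hR)

/-- **CONDITIONAL VARIANCE OF A FINITE MIXTURE, SPLIT FORM** (within-term variances + between-term shifts; the main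
predictor `h z₀` is `m`-measurable): `∫ (g − μ[g|m])² dμ ≤ V z₀ + 2·Σ_{z≠z₀} (V z + Bt z)`. [folklore] -/
theorem integral_sq_sub_condExp_le_of_mixture_split [IsFiniteMeasure μ] [DecidableEq Z] {m : MeasurableSpace Ω}
    (hm : m ≤ mΩ) (labels : Finset Z) (μs : Z → Measure[mΩ] Ω) [∀ z, IsFiniteMeasure (μs z)]
    (hμ : (∑ z ∈ labels, μs z) = μ) {z₀ : Z} (hz₀ : z₀ ∈ labels) {g : Ω → ℝ} {h : Z → Ω → ℝ}
    (hgm : StronglyMeasurable[mΩ] g) (hh₀m : StronglyMeasurable[m] (h z₀))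
    (hhm : ∀ z ∈ labels, StronglyMeasurable[mΩ] (h z))
    {B B' : ℝ} (hgb : ∀ ω, |g ω| ≤ B) (hhb : ∀ z ∈ labels, ∀ ω, |h z ω| ≤ B') {V Bt : Z → ℝ}
    (hV : ∀ z ∈ labels, ∫ ω, (g ω - h z ω) ^ 2 ∂(μs z) ≤ V z)
    (hBt : ∀ z ∈ labels, z ≠ z₀ → ∫ ω, (h z ω - h z₀ ω) ^ 2 ∂(μs z) ≤ Bt z) :
    ∫ ω, (g ω - μ[g|m] ω) ^ 2 ∂μ ≤ V z₀ + 2 * ∑ z ∈ labels.erase z₀, (V z + Bt z) :=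
  (integral_sq_sub_condExp_le_of_version hm hgm hgb hh₀m (hhb z₀ hz₀)).trans
    (integral_sq_sub_le_of_mixture_split labels μs hμ hz₀ hgm hhm hgb hhb hV hBt)

end CondMixture

/-! ## §4 The Poincaré profile of a mixture -/

section ProfileMixture

variable {Ω : Type*} {mΩ : MeasurableSpace Ω} {μ : Measure Ω} {Z β : Type*}

/-- Exchange of the term sum and the site sum with per-site coefficient bounds: if `c z₀ b ≤ C₀` and
`Σ_{z≠z₀} c z b ≤ C′` for every site `b`, then `Σ_b c z₀ b·x b + Σ_{z≠z₀} Σ_b c z b·x b ≤ (C₀ + C′)·Σ_b x b` for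
non-negative `x`. [folklore] -/
theorem sum_sites_terms_le [DecidableEq Z] (labels : Finset Z) (z₀ : Z) (sites : Finset β) (c : Z → β → ℝ)
    {C₀ C' : ℝ} (hc₀ : ∀ b ∈ sites, c z₀ b ≤ C₀) (hc : ∀ b ∈ sites, ∑ z ∈ labels.erase z₀, c z b ≤ C')
    {x : β → ℝ} (hx : ∀ b ∈ sites, 0 ≤ x b) :
    ∑ b ∈ sites, c z₀ b * x b + ∑ z ∈ labels.erase z₀, ∑ b ∈ sites, c z b * x b ≤
      (C₀ + C') * ∑ b ∈ sites, x b := by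
  rw [sum_comm, ← sum_add_distrib, mul_sum]
  refine sum_le_sum fun b hb => ?_
  rw [← sum_mul, ← add_mul]
  exact mul_le_mul_of_nonneg_right (add_le_add (hc₀ b hb) (hc b hb)) (hx b hb)

/-- **THE POINCARÉ PROFILE OF A FINITE MIXTURE** (PROOF-QV §6 (6b) as a `PoincareProfile` combinator).  Data: the
oscillation functional `D` with its three axioms; `μ = Σ_{z∈labels} μs z` with a main label `z₀`; `m₂ ≤ mΩ`,
`m₁ ≤ mΩ`; per-term, per-site coefficients `c z b ≥ 0`-free (only upper bounds are used) with `c z₀ b ≤ C₀`,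
`Σ_{z≠z₀} c z b ≤ C′` on `sites`, `0 ≤ C₀`, `0 ≤ C′`.  Hypothesis (the fibre data): for every bounded
`m₁`-strongly-measurable `g` there is a bounded `m₂`-strongly-measurable MAIN PREDICTOR `h₀` (DICTIONARY: the main
term's fibre mean) with `∫ (g − h₀)² d(μs z₀) ≤ Σ_b c z₀ b·(D b g)²` (leaf (QV) for the main term) and, for every other
term, `∫ (g − h₀)² d(μs z) ≤ Σ_b c z b·(D b g)²` (weight × [far-profile + near-oscillation + mean shift], each of
(QV)∕osc∕(QL) type).  Conclusion: `PoincareProfile μ m₁ m₂ (C₀ + C′) sites D`. [folklore] -/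
theorem poincareProfile_of_mixture [IsFiniteMeasure μ] [DecidableEq Z] {m₁ m₂ : MeasurableSpace Ω}
    (hm₁ : m₁ ≤ mΩ) (hm₂ : m₂ ≤ mΩ) (labels : Finset Z) (μs : Z → Measure[mΩ] Ω) [∀ z, IsFiniteMeasure (μs z)]
    (hμ : (∑ z ∈ labels, μs z) = μ) {z₀ : Z} (hz₀ : z₀ ∈ labels) {sites : Finset β}
    {D : β → (Ω → ℝ) → ℝ} (hD0 : ∀ b, D b (fun _ => 0) = 0) (hDnn : ∀ b g, 0 ≤ D b g)
    (hDadd : ∀ b (g h : Ω → ℝ), D b (fun ω => g ω + h ω) ≤ D b g + D b h) (c : Z → β → ℝ) {C₀ C' : ℝ}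
    (hC₀ : 0 ≤ C₀) (hC' : 0 ≤ C') (hc₀ : ∀ b ∈ sites, c z₀ b ≤ C₀)
    (hc : ∀ b ∈ sites, ∑ z ∈ labels.erase z₀, c z b ≤ C')
    (hfib : ∀ g : Ω → ℝ, StronglyMeasurable[m₁] g → ∀ B : ℝ, (∀ ω, |g ω| ≤ B) →
      ∃ h₀ : Ω → ℝ, ∃ B' : ℝ, StronglyMeasurable[m₂] h₀ ∧ (∀ ω, |h₀ ω| ≤ B') ∧
        ∫ ω, (g ω - h₀ ω) ^ 2 ∂(μs z₀) ≤ ∑ b ∈ sites, c z₀ b * D b g ^ 2 ∧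
        ∀ z ∈ labels, z ≠ z₀ → ∫ ω, (g ω - h₀ ω) ^ 2 ∂(μs z) ≤ ∑ b ∈ sites, c z b * D b g ^ 2) :
    PoincareProfile μ m₁ m₂ (C₀ + C') sites D := by
  refine ⟨add_nonneg hC₀ hC', hD0, hDnn, hDadd, fun g hgm hgB => ?_⟩
  obtain ⟨B, hgb⟩ := hgB
  obtain ⟨h₀, B', hh₀m, hh₀b, hmain, hoth⟩ := hfib g hgm B hgb
  have h1 := integral_sq_sub_condExp_le_of_mixture hm₂ labels μs hμ hz₀ (hgm.mono hm₁) hh₀m hgb hh₀b hmain hoth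
  refine h1.trans ?_
  exact sum_sites_terms_le labels z₀ sites c hc₀ hc fun b _ => sq_nonneg (D b g)

end ProfileMixture

end Summit.QuantumFields.BalabanUV.T4Continuum.NE7LawLevel

end
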